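import Mathlib.Data.ZMod.ValMinAbs
import Literature.Probability.LatticeModels.GibbsSpecification

/-!
# drefute gen 2 — `orbit-kantorovich-finite-size`: the ARITHMETIC step (A) of the face-mode kill, kernel-checked

Companion to `Negative-notes/stub_orbitKantorovichWindow.md` (gen 1) and
`Negative-notes/stub_orbitKantorovichWindow-gen2.md` (this seat).  The face-mode mechanism has four
elementary steps (E1) gauge covariance, (E2) factorisation, (F) admissibility of the single-face-link
test function (Lean: `NegativeNote-stub_orbitKantorovichWindow-FaceMode.lean`), (A) arithmetic, and ONE
physics input (S) (low-temperature locking/switching at a frustrated face site; numerics: kit job of this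
seat).  This file kernel-checks (A) on VERBATIM copies of the skeleton's `CoarseIdx`, `cdist`,
`IsCellLipBound`, `windowAvg`, `windowVol`, `IsKRWindow` (skeleton sha c58ba627e7b2; the
`Cruxes/…/Lines` module is not importable):

* `IsKRWindow.coeff_le` — every single influence coefficient of a window package is bounded by the
  received-sum budget: `k c y x ≤ γ₀ · #{c' : cdist c' x ≤ n}` for `x` in the window of `c` and `y` on its
  shell (nonnegativity + `sum_le`).  So the coefficients are `k`-UNIFORMLY bounded once `(n, γ₀)` are.
* `IsKRWindow.response_le` — `contract` specialised to a test function whose cell-Lipschitz bound is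
  supported on ONE window cell `x` with value `D`: the response of the window average to a boundary change
  on the shell cell `y` is at most `γ₀ · #{c' ∋ x} · D · w y ω η`.
* `IsKRWindow.le_of_response` — contrapositive packaging: a response `≥ c₀` against a boundary pair of
  weight `w y ω η ≤ ε` forces `c₀ ≤ γ₀ · #{c' ∋ x} · D · ε`.
* `eventually_lt_of_tendsto_zero` — hence if along the scheme the SAME response `c₀ > 0` is produced by
  boundary pairs of weight `ε_k → 0` (face mode: `ε_k = 4C/(c₁ α β_k)`, `β_k → ∞`, `α` k-uniform), then
  eventually NO profile `kp` satisfies the window package with k-uniform `(n₀, γ₀)` — which is what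
  `OrbitKRWindowsAlong` (hence `stub_orbitKantorovichWindow`) asserts.
-/

set_option autoImplicit false

noncomputable section

namespace Summit.QuantumFields.YangMills.Cruxes.LatticeGapOnTrajectory.Drefute.FaceModeArithmetic

open scoped BigOperators Topology
open Filter MeasureTheory
open Literature.Probability.LatticeModels (Specification)

/-! ## Verbatim copies of the skeleton's definitions (§1 Cells) -/

abbrev CoarseIdx (μ : Fin 4 → ℕ) : Type := (i : Fin 4) → ZMod (μ i + 1)

def cdist {μ : Fin 4 → ℕ} (x y : CoarseIdx μ) : ℕ :=
  Finset.univ.sup fun i : Fin 4 => ((x i - y i).valMinAbs).natAbs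

variable {ι V S : Type*}

structure IsCellLipBound (cell : V → ι) (w : ι → (V → S) → (V → S) → ℝ) (f : (V → S) → ℝ)
    (δ : ι → ℝ) : Prop where
  nonneg : ∀ c, 0 ≤ δ c
  le : ∀ (c : ι) (σ τ : V → S), (∀ v, cell v ≠ c → σ v = τ v) → |f σ - f τ| ≤ δ c * w c σ τ

variable [MeasurableSpace S]

def windowAvg (γ : Specification V S) (Λ : Finset V) (f : (V → S) → ℝ) (η : V → S) : ℝ :=
  ∫ σ, f σ ∂(γ Λ η)

variable {μ : Fin 4 → ℕ} [Fintype V]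

def windowVol (cell : V → CoarseIdx μ) (n : ℕ) (c : CoarseIdx μ) : Finset V :=
  Finset.univ.filter fun v => cdist c (cell v) ≤ n

structure IsKRWindow (cell : V → CoarseIdx μ) (w : CoarseIdx μ → (V → S) → (V → S) → ℝ)
    (γ : Specification V S) (R : ℝ) (n : ℕ) (γ₀ : ℝ)
    (k : CoarseIdx μ → CoarseIdx μ → CoarseIdx μ → ℝ) : Prop where
  w_nonneg : ∀ c σ τ, 0 ≤ w c σ τ
  w_le : ∀ c σ τ, w c σ τ ≤ R
  w_local : ∀ (c : CoarseIdx μ) (σ σ' τ τ' : V → S), (∀ v, cell v = c → σ v = σ' v) →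
    (∀ v, cell v = c → τ v = τ' v) → w c σ τ = w c σ' τ'
  k_nonneg : ∀ c y x, 0 ≤ k c y x
  range : ∀ (c y : CoarseIdx μ), n + 1 < cdist c y → ∀ (ω η : V → S), (∀ v, cell v ≠ y → ω v = η v) →
    ∀ f : (V → S) → ℝ, Measurable f → (∃ B, ∀ σ, |f σ| ≤ B) →
      DependsOn f {v | cdist c (cell v) ≤ n} →
        windowAvg γ (windowVol cell n c) f ω = windowAvg γ (windowVol cell n c) f η
  contract : ∀ (c y : CoarseIdx μ), n < cdist c y → ∀ (ω η : V → S), (∀ v, cell v ≠ y → ω v = η v) →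
    ∀ (f : (V → S) → ℝ) (δ : CoarseIdx μ → ℝ), Measurable f → (∃ B, ∀ σ, |f σ| ≤ B) →
      DependsOn f {v | cdist c (cell v) ≤ n} → IsCellLipBound cell w f δ →
        |windowAvg γ (windowVol cell n c) f ω - windowAvg γ (windowVol cell n c) f η| ≤
          (∑ x ∈ Finset.univ.filter (fun x => cdist c x ≤ n), k c y x * δ x) * w y ω η
  sum_le : ∀ x : CoarseIdx μ,
    ∑ c ∈ Finset.univ.filter (fun c => cdist c x ≤ n),
        ∑ y ∈ Finset.univ.filter (fun y => cdist c y = n + 1), k c y x ≤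
      γ₀ * (Finset.univ.filter (fun c => cdist c x ≤ n)).card

/-! ## (A) The arithmetic -/

namespace IsKRWindow

variable {cell : V → CoarseIdx μ} {w : CoarseIdx μ → (V → S) → (V → S) → ℝ}
  {γ : Specification V S} {R : ℝ} {n : ℕ} {γ₀ : ℝ}
  {k : CoarseIdx μ → CoarseIdx μ → CoarseIdx μ → ℝ}

/-- Every single coefficient is dominated by the received-sum budget at its interior cell. -/
theorem coeff_le (h : IsKRWindow cell w γ R n γ₀ k) (c y x : CoarseIdx μ)
    (hx : cdist c x ≤ n) (hy : cdist c y = n + 1) :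
    k c y x ≤ γ₀ * (Finset.univ.filter (fun c' => cdist c' x ≤ n)).card := by
  classical
  have h1 : k c y x ≤ ∑ y' ∈ Finset.univ.filter (fun y' => cdist c y' = n + 1), k c y' x :=
    Finset.single_le_sum (f := fun y' => k c y' x) (fun y' _ => h.k_nonneg c y' x)
      (Finset.mem_filter.2 ⟨Finset.mem_univ _, hy⟩)
  have h2 : ∑ y' ∈ Finset.univ.filter (fun y' => cdist c y' = n + 1), k c y' x ≤
      ∑ c' ∈ Finset.univ.filter (fun c' => cdist c' x ≤ n),
        ∑ y' ∈ Finset.univ.filter (fun y' => cdist c' y' = n + 1), k c' y' x :=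
    Finset.single_le_sum
      (f := fun c' => ∑ y' ∈ Finset.univ.filter (fun y' => cdist c' y' = n + 1), k c' y' x)
      (fun c' _ => Finset.sum_nonneg fun y' _ => h.k_nonneg c' y' x)
      (Finset.mem_filter.2 ⟨Finset.mem_univ _, hx⟩)
  exact h1.trans (h2.trans (h.sum_le x))

/-- `contract` at a test function whose cell-Lipschitz bound lives on ONE window cell `x`. -/
theorem response_le (h : IsKRWindow cell w γ R n γ₀ k) (c y x : CoarseIdx μ)
    (hx : cdist c x ≤ n) (hy : cdist c y = n + 1) (ω η : V → S)
    (hagree : ∀ v, cell v ≠ y → ω v = η v) (f : (V → S) → ℝ) (D : ℝ) (hD : 0 ≤ D)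
    (hf : Measurable f) (hfb : ∃ B, ∀ σ, |f σ| ≤ B)
    (hdep : DependsOn f {v | cdist c (cell v) ≤ n})
    (hlip : IsCellLipBound cell w f (fun x' => if x' = x then D else 0)) :
    |windowAvg γ (windowVol cell n c) f ω - windowAvg γ (windowVol cell n c) f η| ≤
      γ₀ * (Finset.univ.filter (fun c' => cdist c' x ≤ n)).card * D * w y ω η := by
  classical
  have hn : n < cdist c y := by omega
  have hcon := h.contract c y hn ω η hagree f _ hf hfb hdep hlip
  have hsum : ∑ x' ∈ Finset.univ.filter (fun x' => cdist c x' ≤ n),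
      k c y x' * (if x' = x then D else 0) = k c y x * D := by
    simp_rw [mul_ite, mul_zero]
    rw [Finset.sum_ite_eq']
    simp [hx]
  rw [hsum] at hcon
  refine hcon.trans ?_
  have hw : 0 ≤ w y ω η := h.w_nonneg y ω η
  have := h.coeff_le c y x hx hy
  nlinarith [mul_nonneg hD hw]

/-- Contrapositive packaging: a response `≥ c₀` against a boundary pair of weight `≤ ε` pins the budget. -/
theorem le_of_response (h : IsKRWindow cell w γ R n γ₀ k) (c y x : CoarseIdx μ)
    (hx : cdist c x ≤ n) (hy : cdist c y = n + 1) (ω η : V → S)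
    (hagree : ∀ v, cell v ≠ y → ω v = η v) (f : (V → S) → ℝ) (D : ℝ) (hD : 0 ≤ D)
    (hf : Measurable f) (hfb : ∃ B, ∀ σ, |f σ| ≤ B)
    (hdep : DependsOn f {v | cdist c (cell v) ≤ n})
    (hlip : IsCellLipBound cell w f (fun x' => if x' = x then D else 0))
    {c₀ ε : ℝ} (hγ₀ : 0 ≤ γ₀)
    (hresp : c₀ ≤ |windowAvg γ (windowVol cell n c) f ω - windowAvg γ (windowVol cell n c) f η|)
    (hε : w y ω η ≤ ε) :
    c₀ ≤ γ₀ * (Finset.univ.filter (fun c' => cdist c' x ≤ n)).card * D * ε := by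
  refine hresp.trans ((h.response_le c y x hx hy ω η hagree f D hD hf hfb hdep hlip).trans ?_)
  exact mul_le_mul_of_nonneg_left hε (by positivity)

end IsKRWindow

/-- If the same response `c₀ > 0` is produced at every step `k` by boundary pairs of weight `ε_k → 0`
(face mode: `ε_k = 4C/(c₁ α β_k)` with `β_k → ∞` and `α` uniform in `k`), the budget inequality of
`le_of_response` fails eventually for every `k`-uniform `(n₀, γ₀, D)`: no profile `kp` can satisfy the
window package along the scheme. -/
theorem eventually_lt_of_tendsto_zero (γ₀ D c₀ : ℝ) (card : ℕ) (ε : ℕ → ℝ)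
    (hε : Tendsto ε atTop (𝓝 0)) (hc₀ : 0 < c₀) :
    ∀ᶠ k in atTop, γ₀ * card * D * ε k < c₀ := by
  have h : Tendsto (fun k => γ₀ * card * D * ε k) atTop (𝓝 (γ₀ * card * D * 0)) :=
    hε.const_mul _
  rw [mul_zero] at h
  exact h.eventually (gt_mem_nhds hc₀)

end Summit.QuantumFields.YangMills.Cruxes.LatticeGapOnTrajectory.Drefute.FaceModeArithmetic

end
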